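import Literature.Topology.FourManifolds.ModelTemplate
import Literature.Analysis.Calculus.ScaledDifference
import HarnessLib

/-!
# The scaled template: the template loop with its band pieces at scale `κ`, smoothly in `κ`

Topic `Literature/Topology/FourManifolds` (trunk T-4MAN). Fact seat
`provefact-Literature.Topology.FourManifolds.Knot.IsConnectedSum.isIsotopic` (Schubert's theorem),
geometric heart for rail knots, flattening step. The template loop of `ModelTemplate.lean` is the
`κ = 0` member of a family of loops in blow-up coordinates, jointly `C^∞` in the scale `κ` and
the parameter: the planar band pieces `(Z₀, Z₁, 0)` of the template (the neck lines and the
flipped hairpin) are replaced by the **band quotient**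

  `bandQuot κ Z = frame⁻¹ (κ⁻¹ (Fband (κ Z) - pZero))`  (`κ ≠ 0`),  `= (Z₀, Z₁, 0)` (`κ = 0`),

which is jointly `C^∞` in `(κ, Z)` by Hadamard's lemma in the scaling variable
(`Literature.Analysis.Calculus.scaledDiff`, after localising `Fband` to its smooth ball). For
`κ ≠ 0` small, `bandQuot κ Z = blowUp κ (Fband (κ Z))` is the blow-up of the true band point, so
the scaled template at scale `κ` will be identified (in the flattening file) with the blow-up of
the host loop at scale `κ`; at `κ = 0` it is the template. Here: the definition
(`scaledRaw σ κ p`, `scaled σ κ`), the zone and overlap identities uniformly in `κ`, joint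
smoothness (`contDiff_scaled_uncurry`), periodicity, and `scaled σ 0 = template σ`.

Everything is proved; no named facts are introduced.

## References

* J. Milnor, *Morse theory* (1963), Lemma 2.1 (Hadamard's lemma). [folklore]
* M. W. Hirsch, *Differential Topology*, GTM 33 (1976), Ch. 8 §1, proof of Thm. 1.6. [HirschDT1976]
-/

open scoped Manifold ContDiff Topology Real
open Function Set Metric Filter

noncomputable section

namespace Literature.Topology.FourManifolds

/-- Local notation: `𝔼 n` is the model Euclidean space `EuclideanSpace ℝ (Fin n)`. -/
local notation "𝔼 " n:arg => EuclideanSpace ℝ (Fin n)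

attribute [local instance] fact_finrank_euclideanSpace_succ

open KnotsInBall ExitBend ModelTemplate Literature.Analysis.Calculus

namespace BandData

variable {A B K : Knot} {avoid : Set (Metric.sphere (0 : EuclideanSpace ℝ (Fin 4)) 1)} (b : BandData A B K avoid)
  (hcross : b.band ⁻¹' sphereEquator 2 ∩ squareNhd b.δ = {x ∈ squareNhd b.δ | x 0 = 2⁻¹})

/-! ### The band quotient -/

/-- `Fband` is `C^∞` on the open pole-free ball. [folklore] -/
theorem contDiffOn_Fband : ContDiffOn ℝ ∞ b.Fband (ball 0 (b.poleRad hcross)) := fun q hq ↦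
  (b.contDiffAt_Fband hcross (by simpa using hq)).contDiffWithinAt

/-- **The band quotient** at scale `κ`: `frame⁻¹` of the scaled difference quotient of (the
localised) `Fband` — `frame⁻¹ (κ⁻¹ (Fband (κ Z) - pZero))` for small `κ ≠ 0`, `(Z₀, Z₁, 0)` at
`κ = 0`. [folklore] -/
def bandQuot (κ : ℝ) (Z : 𝔼 2) : 𝔼 3 :=
  (b.frame hcross).symm (scaledDiff (ballLocalize b.Fband (b.poleRad hcross)) κ Z)

/-- **The band quotient is jointly `C^∞` in `(κ, Z)`.** [folklore] -/
theorem contDiff_bandQuot : ContDiff ℝ ∞ fun p : ℝ × 𝔼 2 ↦ b.bandQuot hcross p.1 p.2 :=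
  ((b.frame hcross).symm : (𝔼 3) →L[ℝ] 𝔼 3).contDiff.comp
    (contDiff_scaledDiff_ballLocalize (b.poleRad_pos hcross).1 (b.contDiffOn_Fband hcross))

/-- The band quotient is `C^∞` along a `C^∞` pair of maps. [folklore] -/
theorem contDiff_bandQuot_comp {X : Type*} [NormedAddCommGroup X] [NormedSpace ℝ X] {k : X → ℝ} {Z : X → 𝔼 2}
    (hk : ContDiff ℝ ∞ k) (hZ : ContDiff ℝ ∞ Z) : ContDiff ℝ ∞ fun x ↦ b.bandQuot hcross (k x) (Z x) := by
  have h := (b.contDiff_bandQuot hcross).comp (hk.prodMk hZ)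
  exact h

/-- **At `κ = 0` the band quotient is the planar inclusion** `(Z₀, Z₁, 0)`. [folklore] -/
theorem bandQuot_zero (Z : 𝔼 2) : b.bandQuot hcross 0 Z = pt3 (Z 0) (Z 1) 0 := by
  rw [bandQuot, scaledDiff_ballLocalize_zero_left (b.poleRad_pos hcross).1, b.fderiv_Fband_zero_apply hcross,
    ContinuousLinearEquiv.symm_apply_apply]

/-- The band quotient at `κ = 0` on `pt2`. [folklore] -/
theorem bandQuot_zero_pt2 (a v : ℝ) : b.bandQuot hcross 0 (pt2 a v) = pt3 a v 0 := by
  rw [bandQuot_zero]; rfl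

/-- **For small `κ ≠ 0` the band quotient is the blow-up of the band point `Fband (κ Z)`.**
[folklore] -/
theorem bandQuot_of_ne_zero {κ : ℝ} (hκ : κ ≠ 0) {Z : 𝔼 2} (hZ : ‖κ • Z‖ ≤ b.poleRad hcross / 2) :
    b.bandQuot hcross κ Z = b.blowUp hcross κ (b.Fband (κ • Z)) := by
  rw [bandQuot, scaledDiff_ballLocalize_of_ne_zero (b.poleRad_pos hcross).1 (b.contDiffOn_Fband hcross) hκ hZ, blowUp,
    map_smul]
  rfl

/-- The blow-down of the band quotient is the band point (small `κ ≠ 0`). [folklore] -/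
theorem blowDown_bandQuot {κ : ℝ} (hκ : κ ≠ 0) {Z : 𝔼 2} (hZ : ‖κ • Z‖ ≤ b.poleRad hcross / 2) :
    b.blowDown hcross κ (b.bandQuot hcross κ Z) = b.Fband (κ • Z) := by
  rw [b.bandQuot_of_ne_zero hcross hκ hZ, b.blowDown_blowUp hcross hκ]

/-! ### The scaled pieces -/

/-- **The scaled lower native piece**: band quotient of the lower neck line blended by the spike
bump into the lower model path. [folklore] -/
def lowerPiece (σ κ α : ℝ) : 𝔼 3 :=
  (1 - spikeBump α) • b.bandQuot hcross κ (pt2 α (-1)) + spikeBump α • modelLo σ α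

/-- **The scaled upper native piece.** [folklore] -/
def upperPiece (σ κ α : ℝ) : 𝔼 3 :=
  (1 - spikeBump α) • b.bandQuot hcross κ (pt2 α 1) + spikeBump α • modelHi σ α

/-- **The scaled foreign piece**: band quotient of the flipped hairpin. [folklore] -/
def foreignPiece (κ q : ℝ) : 𝔼 3 := b.bandQuot hcross κ (-hairpin q)

/-- **THE SCALED RAW TEMPLATE** (same zones as `templateRaw`). [folklore] -/
def scaledRaw (σ κ p : ℝ) : 𝔼 3 :=
  if p ≤ -(7 / 8) then b.lowerPiece hcross σ κ (levLoOfP p)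
  else if p ≤ 7 / 16 then cO σ + p • dLo σ
  else if p ≤ 11 / 12 then bendArc σ (1 / 8) p 1
  else if p ≤ 4 then b.upperPiece hcross σ κ (levHiOfP p)
  else b.foreignPiece hcross κ (qOfP p)

/-- At `κ = 0` the lower piece is the lower model. [folklore] -/
theorem lowerPiece_zero (σ α : ℝ) : b.lowerPiece hcross σ 0 α = lowerModel σ α := by
  rw [lowerPiece, bandQuot_zero_pt2, lowerModel]

/-- At `κ = 0` the upper piece is the upper model. [folklore] -/
theorem upperPiece_zero (σ α : ℝ) : b.upperPiece hcross σ 0 α = upperModel σ α := by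
  rw [upperPiece, bandQuot_zero_pt2, upperModel]

/-- At `κ = 0` the foreign piece is the foreign model. [folklore] -/
theorem foreignPiece_zero (q : ℝ) : b.foreignPiece hcross 0 q = foreignModel q := by
  rw [foreignPiece, bandQuot_zero, foreignModel]
  rfl

/-- **At `κ = 0` the scaled raw template is the raw template.** [folklore] -/
theorem scaledRaw_zero (σ p : ℝ) : b.scaledRaw hcross σ 0 p = templateRaw σ p := by
  simp only [scaledRaw, templateRaw, lowerPiece_zero, upperPiece_zero, foreignPiece_zero]

/-! ### Smoothness of the pieces (jointly in the scale) -/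

/-- The lower piece is jointly `C^∞` in `(κ, α)`. [folklore] -/
theorem contDiff_lowerPiece (σ : ℝ) : ContDiff ℝ ∞ fun x : ℝ × ℝ ↦ b.lowerPiece hcross σ x.1 x.2 := by
  have hβ : ContDiff ℝ ∞ fun x : ℝ × ℝ ↦ spikeBump x.2 := contDiff_spikeBump.comp contDiff_snd
  have hZ : ContDiff ℝ ∞ fun x : ℝ × ℝ ↦ (pt2 x.2 (-1) : 𝔼 2) := by
    have e : (fun x : ℝ × ℝ ↦ (pt2 x.2 (-1) : 𝔼 2)) = fun x ↦ (pt2 0 (-1) : 𝔼 2) + x.2 • pt2 1 0 := by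
      funext x; ext i; fin_cases i <;> simp
    rw [e]; exact contDiff_const.add (contDiff_snd.smul contDiff_const)
  have hQ := b.contDiff_bandQuot_comp hcross contDiff_fst hZ
  have hM : ContDiff ℝ ∞ fun x : ℝ × ℝ ↦ modelLo σ x.2 := (contDiff_modelLo σ).comp contDiff_snd
  unfold lowerPiece
  exact ((contDiff_const.sub hβ).smul hQ).add (hβ.smul hM)

/-- The upper piece is jointly `C^∞` in `(κ, α)`. [folklore] -/
theorem contDiff_upperPiece (σ : ℝ) : ContDiff ℝ ∞ fun x : ℝ × ℝ ↦ b.upperPiece hcross σ x.1 x.2 := by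
  have hβ : ContDiff ℝ ∞ fun x : ℝ × ℝ ↦ spikeBump x.2 := contDiff_spikeBump.comp contDiff_snd
  have hZ : ContDiff ℝ ∞ fun x : ℝ × ℝ ↦ (pt2 x.2 1 : 𝔼 2) := by
    have e : (fun x : ℝ × ℝ ↦ (pt2 x.2 1 : 𝔼 2)) = fun x ↦ (pt2 0 1 : 𝔼 2) + x.2 • pt2 1 0 := by
      funext x; ext i; fin_cases i <;> simp
    rw [e]; exact contDiff_const.add (contDiff_snd.smul contDiff_const)
  have hQ := b.contDiff_bandQuot_comp hcross contDiff_fst hZ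
  have hM : ContDiff ℝ ∞ fun x : ℝ × ℝ ↦ modelHi σ x.2 := (contDiff_modelHi σ).comp contDiff_snd
  unfold upperPiece
  exact ((contDiff_const.sub hβ).smul hQ).add (hβ.smul hM)

/-- The foreign piece is jointly `C^∞` in `(κ, q)`. [folklore] -/
theorem contDiff_foreignPiece : ContDiff ℝ ∞ fun x : ℝ × ℝ ↦ b.foreignPiece hcross x.1 x.2 := by
  have hH : ContDiff ℝ ∞ fun x : ℝ × ℝ ↦ -hairpin x.2 := (contDiff_hairpin.comp contDiff_snd).neg
  unfold foreignPiece
  exact b.contDiff_bandQuot_comp hcross contDiff_fst hH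

/-! ### The overlap identities, uniformly in the scale -/

/-- **Lower overlap** (`p ∈ [-1, -3/4]`): the lower piece is the straight segment. [folklore] -/
theorem lowerPiece_eq_seg (σ κ : ℝ) {p : ℝ} (hp : p ∈ Icc (-1 : ℝ) (-(3 / 4))) :
    b.lowerPiece hcross σ κ (levLoOfP p) = cO σ + p • dLo σ := by
  have hα : levLoOfP p ∈ Icc (1 / 4 : ℝ) (7 / 16) := by simp only [levLoOfP, mem_Icc]; constructor <;> linarith [hp.1, hp.2]
  rw [lowerPiece, spikeBump_eq_one ⟨hα.1, by linarith [hα.2]⟩, sub_self, zero_smul, zero_add, one_smul, modelLo,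
    spikeProfile_of_le (by linarith [hα.2])]
  ext i; fin_cases i <;> simp [pt3, cO, dLo, levLoOfP] <;> ring

/-- **Upper overlap** (`p ∈ [5/6, 1]`): the upper piece is the upper ray. [folklore] -/
theorem upperPiece_eq_ray (σ κ : ℝ) {p : ℝ} (hp : p ∈ Icc (5 / 6 : ℝ) 1) :
    b.upperPiece hcross σ κ (levHiOfP p) = cO σ + p • dHi σ := by
  have hα : levHiOfP p ∈ Icc (1 / 4 : ℝ) (3 / 8) := by simp only [levHiOfP, mem_Icc]; constructor <;> linarith [hp.1, hp.2]
  rw [upperPiece, spikeBump_eq_one ⟨hα.1, by linarith [hα.2]⟩, sub_self, zero_smul, zero_add, one_smul, modelHi,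
    spikeProfile_of_le (by linarith [hα.2])]
  ext i; fin_cases i <;> simp [pt3, cO, dHi, levHiOfP] <;> ring

/-- The flipped lower turn of low level is the upper neck point: `-(lowerTurn a) = (-a, 1)` for
`a ≤ 7/2`. [folklore] -/
theorem neg_lowerTurn_of_le {a : ℝ} (ha : a ≤ 7 / 2) : -(lowerTurn a) = (pt2 (-a) 1 : 𝔼 2) := by
  rw [lowerTurn, turnX_of_le ha, turnV_of_le (by linarith)]
  ext i; fin_cases i <;> simp

/-- The flipped upper turn of low level is the lower neck point: `-(upperTurn a) = (-a, -1)` for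
`a ≤ 7/2`. [folklore] -/
theorem neg_upperTurn_of_le {a : ℝ} (ha : a ≤ 7 / 2) : -(upperTurn a) = (pt2 (-a) (-1) : 𝔼 2) := by
  rw [upperTurn, turnX_of_le ha, turnV_of_le (by linarith)]
  ext i; fin_cases i <;> simp

/-- **Upper junction overlap** (`p ∈ [8/3, 6]`): the upper piece (upper neck at level
`levHiOfP p ≤ -1`) is the foreign piece. [folklore] -/
theorem upperPiece_eq_foreign (σ κ : ℝ) {p : ℝ} (hp : p ∈ Icc (8 / 3 : ℝ) 6) :
    b.upperPiece hcross σ κ (levHiOfP p) = b.foreignPiece hcross κ (qOfP p) := by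
  have hα : levHiOfP p ≤ 1 / 8 := by simp only [levHiOfP]; linarith [hp.1]
  have hq : qOfP p ≤ -(3 / 8) := by simp only [qOfP]; linarith [hp.2]
  have ha : levOfClockLo (qOfP p) ≤ 7 / 2 := by simp only [levOfClockLo, qOfP]; linarith [hp.2]
  rw [upperPiece, spikeBump_eq_zero_of_le hα, sub_zero, one_smul, zero_smul, add_zero, foreignPiece, hairpin_of_le hq,
    neg_lowerTurn_of_le ha]
  congr 1
  ext i; fin_cases i <;> (simp [levHiOfP, levOfClockLo, qOfP]; try ring)

/-- **The seam identity** (`p ∈ [-6, -7/6]`): one period on, the foreign piece is the lower piece.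
[folklore] -/
theorem foreign_eq_lowerPiece (σ κ : ℝ) {p : ℝ} (hp : p ∈ Icc (-6 : ℝ) (-(7 / 6))) :
    b.foreignPiece hcross κ (qOfP (p + 18)) = b.lowerPiece hcross σ κ (levLoOfP p) := by
  have hα : levLoOfP p ≤ 1 / 8 := by simp only [levLoOfP]; linarith [hp.2]
  have hq : 3 / 8 ≤ qOfP (p + 18) := by simp only [qOfP]; linarith [hp.1]
  have ha : levOfClockHi (qOfP (p + 18)) ≤ 7 / 2 := by simp only [levOfClockHi, qOfP]; linarith [hp.1]
  rw [lowerPiece, spikeBump_eq_zero_of_le hα, sub_zero, one_smul, zero_smul, add_zero, foreignPiece, hairpin_of_ge hq,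
    neg_upperTurn_of_le ha]
  congr 1
  ext i; fin_cases i <;> (simp [levLoOfP, levOfClockHi, qOfP]; try ring)

/-! ### Zone formulas -/

/-- Zone 1: `p ≤ -7/8`. [folklore] -/
theorem scaledRaw_of_le {σ κ p : ℝ} (h : p ≤ -(7 / 8)) : b.scaledRaw hcross σ κ p = b.lowerPiece hcross σ κ (levLoOfP p) := by
  simp [scaledRaw, h]

/-- Zone 1 extended by the overlap: `p ≤ -3/4`. [folklore] -/
theorem scaledRaw_of_le' {σ κ p : ℝ} (h : p ≤ -(3 / 4)) : b.scaledRaw hcross σ κ p = b.lowerPiece hcross σ κ (levLoOfP p) := by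
  rcases le_or_gt p (-(7 / 8)) with h1 | h1
  · exact b.scaledRaw_of_le hcross h1
  · rw [lowerPiece_eq_seg _ _ σ κ ⟨by linarith, h⟩]
    simp [scaledRaw, not_le.2 h1, show p ≤ 7 / 16 by linarith]

/-- Zone 2 (with the overlap): `p ∈ [-1, 7/16]`. [folklore] -/
theorem scaledRaw_of_mem_seg {σ κ p : ℝ} (h : p ∈ Icc (-1 : ℝ) (7 / 16)) : b.scaledRaw hcross σ κ p = cO σ + p • dLo σ := by
  rcases le_or_gt p (-(7 / 8)) with h1 | h1
  · rw [scaledRaw_of_le _ _ h1, lowerPiece_eq_seg _ _ σ κ ⟨h.1, by linarith⟩]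
  · simp [scaledRaw, not_le.2 h1, h.2]

/-- Zone 2 extended by the arc overlap: `p ∈ [-1, 1/2]`. [folklore] -/
theorem scaledRaw_of_mem_seg' {σ κ p : ℝ} (h : p ∈ Icc (-1 : ℝ) (1 / 2)) : b.scaledRaw hcross σ κ p = cO σ + p • dLo σ := by
  rcases le_or_gt p (7 / 16) with h1 | h1
  · exact b.scaledRaw_of_mem_seg hcross ⟨h.1, h1⟩
  · have : b.scaledRaw hcross σ κ p = bendArc σ (1 / 8) p 1 := by
      simp [scaledRaw, not_le.2 (show -(7 / 8 : ℝ) < p by linarith), not_le.2 h1, show p ≤ 11 / 12 by linarith [h.2]]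
    rw [this, bendArc_eq_seg σ ⟨by linarith, h.2⟩]

/-- Zone 3 (with the overlaps): `p ∈ [1/4, 1]`. [folklore] -/
theorem scaledRaw_of_mem_arc {σ κ p : ℝ} (h : p ∈ Icc (1 / 4 : ℝ) 1) : b.scaledRaw hcross σ κ p = bendArc σ (1 / 8) p 1 := by
  rcases le_or_gt p (7 / 16) with h1 | h1
  · rw [scaledRaw_of_mem_seg _ _ ⟨by linarith [h.1], h1⟩, bendArc_eq_seg σ ⟨h.1, by linarith⟩]
  rcases le_or_gt p (11 / 12) with h2 | h2
  · simp [scaledRaw, not_le.2 (show -(7 / 8 : ℝ) < p by linarith), not_le.2 h1, h2]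
  · have : b.scaledRaw hcross σ κ p = b.upperPiece hcross σ κ (levHiOfP p) := by
      simp [scaledRaw, not_le.2 (show -(7 / 8 : ℝ) < p by linarith), not_le.2 h1, not_le.2 h2, show p ≤ 4 by linarith [h.2]]
    rw [this, upperPiece_eq_ray _ _ σ κ ⟨by linarith, h.2⟩, bendArc_eq_ray σ ⟨by linarith, h.2⟩]

/-- Zone 4 (with the overlaps): `p ∈ [5/6, 6]`. [folklore] -/
theorem scaledRaw_of_mem_upper {σ κ p : ℝ} (h : p ∈ Icc (5 / 6 : ℝ) 6) :
    b.scaledRaw hcross σ κ p = b.upperPiece hcross σ κ (levHiOfP p) := by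
  rcases le_or_gt p (11 / 12) with h1 | h1
  · rw [scaledRaw_of_mem_arc _ _ ⟨by linarith [h.1], by linarith⟩, bendArc_eq_ray σ ⟨by linarith [h.1], by linarith⟩,
      upperPiece_eq_ray _ _ σ κ ⟨h.1, by linarith⟩]
  rcases le_or_gt p 4 with h2 | h2
  · simp [scaledRaw, not_le.2 (show -(7 / 8 : ℝ) < p by linarith [h.1]), not_le.2 (show (7 / 16 : ℝ) < p by linarith [h.1]),
      not_le.2 h1, h2]
  · have : b.scaledRaw hcross σ κ p = b.foreignPiece hcross κ (qOfP p) := by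
      simp [scaledRaw, not_le.2 (show -(7 / 8 : ℝ) < p by linarith [h.1]), not_le.2 (show (7 / 16 : ℝ) < p by linarith [h.1]),
        not_le.2 h1, not_le.2 h2]
    rw [this, upperPiece_eq_foreign _ _ σ κ ⟨by linarith, h.2⟩]

/-- Zone 5 (with the overlap): `8/3 ≤ p`. [folklore] -/
theorem scaledRaw_of_ge {σ κ p : ℝ} (h : 8 / 3 ≤ p) : b.scaledRaw hcross σ κ p = b.foreignPiece hcross κ (qOfP p) := by
  rcases le_or_gt p 4 with h1 | h1
  · rw [scaledRaw_of_mem_upper _ _ ⟨by linarith, by linarith⟩, upperPiece_eq_foreign _ _ σ κ ⟨h, by linarith⟩]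
  · simp [scaledRaw, not_le.2 (show -(7 / 8 : ℝ) < p by linarith), not_le.2 (show (7 / 16 : ℝ) < p by linarith),
      not_le.2 (show (11 / 12 : ℝ) < p by linarith), not_le.2 h1]

/-- The lower zone one period on (`p ∈ [14, 16]`): the foreign piece there is the lower piece at
`p - 18`. [folklore] -/
theorem scaledRaw_of_mem_late {σ κ p : ℝ} (h : p ∈ Icc (14 : ℝ) 16) :
    b.scaledRaw hcross σ κ p = b.lowerPiece hcross σ κ (levLoOfP (p - 18)) := by
  rw [scaledRaw_of_ge _ _ (by linarith [h.1]), ← foreign_eq_lowerPiece _ _ σ κ (p := p - 18) ⟨by linarith [h.1], by linarith [h.2]⟩,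
    sub_add_cancel]

/-! ### Joint smoothness of the scaled raw template -/

/-- **THE SCALED RAW TEMPLATE IS JOINTLY `C^∞` IN `(κ, p)`.** [folklore] -/
theorem contDiff_scaledRaw (σ : ℝ) : ContDiff ℝ ∞ fun x : ℝ × ℝ ↦ b.scaledRaw hcross σ x.1 x.2 := by
  have hlo : ContDiff ℝ ∞ fun x : ℝ × ℝ ↦ b.lowerPiece hcross σ x.1 (levLoOfP x.2) := by
    have h := (b.contDiff_lowerPiece hcross σ).comp ((contDiff_fst (E := ℝ) (F := ℝ)).prodMk
      (contDiff_const.add (contDiff_const.mul (contDiff_snd.add contDiff_const)) :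
        ContDiff ℝ ∞ fun x : ℝ × ℝ ↦ levLoOfP x.2))
    exact h
  have hseg : ContDiff ℝ ∞ fun x : ℝ × ℝ ↦ cO σ + x.2 • dLo σ := contDiff_const.add (contDiff_snd.smul contDiff_const)
  have harc : ContDiff ℝ ∞ fun x : ℝ × ℝ ↦ bendArc σ (1 / 8) x.2 1 := (contDiff_bendArc_one σ).comp contDiff_snd
  have hup : ContDiff ℝ ∞ fun x : ℝ × ℝ ↦ b.upperPiece hcross σ x.1 (levHiOfP x.2) := by
    have h := (b.contDiff_upperPiece hcross σ).comp ((contDiff_fst (E := ℝ) (F := ℝ)).prodMk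
      (contDiff_const.sub (contDiff_const.mul (contDiff_snd.sub contDiff_const)) :
        ContDiff ℝ ∞ fun x : ℝ × ℝ ↦ levHiOfP x.2))
    exact h
  have hfor : ContDiff ℝ ∞ fun x : ℝ × ℝ ↦ b.foreignPiece hcross x.1 (qOfP x.2) := by
    have h := (b.contDiff_foreignPiece hcross).comp ((contDiff_fst (E := ℝ) (F := ℝ)).prodMk
      ((contDiff_const.mul (contDiff_snd.sub contDiff_const)).sub contDiff_const :
        ContDiff ℝ ∞ fun x : ℝ × ℝ ↦ qOfP x.2))
    exact h
  have hopen_lt : ∀ c : ℝ, IsOpen {x : ℝ × ℝ | x.2 < c} := fun c ↦ isOpen_lt continuous_snd continuous_const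
  have hopen_gt : ∀ c : ℝ, IsOpen {x : ℝ × ℝ | c < x.2} := fun c ↦ isOpen_lt continuous_const continuous_snd
  refine contDiff_iff_contDiffAt.2 fun x ↦ ?_
  rcases lt_or_ge x.2 (-(15 / 16)) with h1 | h1
  · exact hlo.contDiffAt.congr_of_eventuallyEq (by
      filter_upwards [(hopen_lt (-(7 / 8))).mem_nhds (show x.2 < -(7 / 8) by linarith)] with y hy
        using b.scaledRaw_of_le hcross (le_of_lt hy))
  rcases lt_or_ge x.2 (3 / 8) with h2 | h2
  · exact hseg.contDiffAt.congr_of_eventuallyEq (by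
      filter_upwards [(hopen_gt (-1)).mem_nhds (show (-1 : ℝ) < x.2 by linarith),
        (hopen_lt (7 / 16)).mem_nhds (show x.2 < 7 / 16 by linarith)] with y hy hy'
        using b.scaledRaw_of_mem_seg hcross ⟨le_of_lt hy, le_of_lt hy'⟩)
  rcases lt_or_ge x.2 (7 / 8) with h3 | h3
  · exact harc.contDiffAt.congr_of_eventuallyEq (by
      filter_upwards [(hopen_gt (1 / 4)).mem_nhds (show (1 / 4 : ℝ) < x.2 by linarith),
        (hopen_lt 1).mem_nhds (show x.2 < 1 by linarith)] with y hy hy'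
        using b.scaledRaw_of_mem_arc hcross ⟨le_of_lt hy, le_of_lt hy'⟩)
  rcases lt_or_ge x.2 3 with h4 | h4
  · exact hup.contDiffAt.congr_of_eventuallyEq (by
      filter_upwards [(hopen_gt (5 / 6)).mem_nhds (show (5 / 6 : ℝ) < x.2 by linarith),
        (hopen_lt 6).mem_nhds (show x.2 < 6 by linarith)] with y hy hy'
        using b.scaledRaw_of_mem_upper hcross ⟨le_of_lt hy, le_of_lt hy'⟩)
  · exact hfor.contDiffAt.congr_of_eventuallyEq (by
      filter_upwards [(hopen_gt (8 / 3)).mem_nhds (show (8 / 3 : ℝ) < x.2 by linarith)] with y hy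
        using b.scaledRaw_of_ge hcross (le_of_lt hy))

/-- The scaled raw template is `C^∞` in `p` at fixed scale. [folklore] -/
theorem contDiff_scaledRaw_right (σ κ : ℝ) : ContDiff ℝ ∞ (b.scaledRaw hcross σ κ) := by
  have h := (b.contDiff_scaledRaw hcross σ).comp
    ((contDiff_const (c := κ)).prodMk (contDiff_id (E := ℝ)) : ContDiff ℝ ∞ fun p : ℝ ↦ (κ, p))
  exact h

/-! ### The scaled template loop (period one) -/

/-- **THE SCALED TEMPLATE LOOP** at scale `κ`: the scaled raw template rescaled to period `1` and
periodised from the fundamental domain `[-4/18, 14/18)`. [folklore] -/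
def scaled (σ κ : ℝ) : ℝ → 𝔼 3 := periodise (-(4 / 18)) fun s ↦ b.scaledRaw hcross σ κ (18 * s)

/-- **The seam of the scaled template**, uniformly in `κ`. [folklore] -/
theorem scaledRaw_seam (σ κ : ℝ) {s : ℝ} (hs : s ∈ Ioo (-(6 / 18) : ℝ) (-(7 / 108))) :
    b.scaledRaw hcross σ κ (18 * (s + 1)) = b.scaledRaw hcross σ κ (18 * s) := by
  have h1 : 18 * s ∈ Icc (-6 : ℝ) (-(7 / 6)) := ⟨by linarith [hs.1], by linarith [hs.2]⟩
  rw [show 18 * (s + 1) = 18 * s + 18 by ring, scaledRaw_of_ge _ _ (by linarith [hs.1]), scaledRaw_of_le _ _ (by linarith [hs.2]),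
    foreign_eq_lowerPiece _ _ σ κ h1]

/-- **The scaled template loop is jointly `C^∞` in `(κ, s)`.** [folklore] -/
theorem contDiff_scaled_uncurry (σ : ℝ) : ContDiff ℝ ∞ fun x : ℝ × ℝ ↦ b.scaled hcross σ x.1 x.2 := by
  have hF : ContDiff ℝ ∞ (uncurry fun κ s ↦ b.scaledRaw hcross σ κ (18 * s)) := by
    have h := (b.contDiff_scaledRaw hcross σ).comp
      ((contDiff_fst (E := ℝ) (F := ℝ)).prodMk (contDiff_const.mul contDiff_snd : ContDiff ℝ ∞ fun x : ℝ × ℝ ↦ 18 * x.2))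
    exact h
  exact contDiff_periodise_family (a := -(4 / 18)) (F := fun κ s ↦ b.scaledRaw hcross σ κ (18 * s)) (ε := 1 / 18)
    hF (by norm_num) fun κ s hs ↦ b.scaledRaw_seam hcross σ κ ⟨by linarith [hs.1], by linarith [hs.2]⟩

/-- The scaled template loop is `C^∞` at fixed scale. [folklore] -/
theorem contDiff_scaled (σ κ : ℝ) : ContDiff ℝ ∞ (b.scaled hcross σ κ) := by
  have h := (b.contDiff_scaled_uncurry hcross σ).comp
    ((contDiff_const (c := κ)).prodMk (contDiff_id (E := ℝ)) : ContDiff ℝ ∞ fun s : ℝ ↦ (κ, s))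
  exact h

/-- The scaled template loop is `1`-periodic. [folklore] -/
theorem periodic_scaled (σ κ : ℝ) : Periodic (b.scaled hcross σ κ) 1 := periodic_periodise _ _

/-- On the fundamental domain `[-4/18, 14/18)` the scaled template is the rescaled raw one. [folklore] -/
theorem scaled_eq {σ κ s : ℝ} (hs : s ∈ Ico (-(4 / 18) : ℝ) (-(4 / 18) + 1)) :
    b.scaled hcross σ κ s = b.scaledRaw hcross σ κ (18 * s) :=
  periodise_eq_self _ _ hs

/-- **On the extended domain `[-4/18, 16/18]` the scaled template is still the rescaled raw one**
(the raw template is `18`-periodic across the seam there). [folklore] -/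
theorem scaled_eq' {σ κ s : ℝ} (hs : s ∈ Icc (-(4 / 18) : ℝ) (16 / 18)) :
    b.scaled hcross σ κ s = b.scaledRaw hcross σ κ (18 * s) := by
  rcases lt_or_ge s (-(4 / 18) + 1) with h | h
  · exact b.scaled_eq hcross ⟨hs.1, h⟩
  · have h1 : s - 1 ∈ Ico (-(4 / 18) : ℝ) (-(4 / 18) + 1) := ⟨by linarith, by linarith [hs.2]⟩
    rw [← (b.periodic_scaled hcross σ κ).sub_eq s, b.scaled_eq hcross h1,
      b.scaledRaw_of_le hcross (p := 18 * (s - 1)) (by linarith [hs.2]),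
      b.scaledRaw_of_mem_late hcross (p := 18 * s) ⟨by linarith, by linarith [hs.2]⟩]
    congr 2; ring

/-- **AT `κ = 0` THE SCALED TEMPLATE IS THE TEMPLATE.** [folklore] -/
theorem scaled_zero (σ : ℝ) : b.scaled hcross σ 0 = template σ := by
  funext s
  simp only [scaled, template, periodise, scaledRaw_zero]

end BandData

end Literature.Topology.FourManifolds
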